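import Summits.Parity.GeneralizedHardyLittlewood.Theorems.BeyondDiagonalBeatsQuarter.OffDiagPoissonTwisted
import Summits.Parity.GeneralizedHardyLittlewood.Theorems.BeyondDiagonalBeatsQuarter.OffDiagZeroFrequency
import Mathlib.Analysis.Calculus.ContDiff.Basic
import HarnessLib

/-!
# Route `PrimeLevelFamEdge`, crux K_B (stmt-Parity-20343), line `diagonal_kernel_split`, plan Ω,
# sub-line **d1** (part 2) — the twisted Poisson formula for a SMOOTH compactly supported weight on `ℝ²`,
# in the Kloosterman shape of d2

Part 1 (`OffDiagPoissonTwisted`) proves the two-variable twisted Poisson formula under the five analytic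
hypotheses of the tree's `FriedlanderIwaniecPrimes.tsum_tsum_arithProg₂` (box support `R`, joint
continuity, smooth slices in each variable, `sup_{t₂} ∫ |∂₁²Φ(·,t₂)| ≤ C₁`). The dyadic pieces produced by
d4 (`OffDiagDyadic`) are smooth compactly supported functions on `ℝ²`; this file discharges the five
hypotheses from `ContDiff ℝ ∞ (uncurry Φ)` + `HasCompactSupport (uncurry Φ)` (lead's ASK, STATUS
2026-08-28T13:12Z), and rewrites the complete character sums in the EXACT shape of d2
(`OffDiag.sum_sum_kloostermanSum_mul_stdAddChar`: `Σ_{x₁,x₂ : ZMod c} K x₁ x₂ · e_c(h₁x₁ + h₂x₂)` with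
Mathlib's `ZMod.stdAddChar`):

* slices of a smooth `F = uncurry Φ`: `iteratedDeriv n (Φ(·,t₂)) t₁ = D^nF(t₁,t₂)·(e₁,…,e₁)`
  (`iteratedDeriv_slice_left/right`, from Mathlib's `ContinuousLinearMap.iteratedFDeriv_comp_right` and
  `iteratedFDeriv_comp_add_right`), hence `|∂₁ⁿΦ(t₁,t₂)| ≤ ‖D^nF(t₁,t₂)‖`, vanishing off `tsupport F`;
* `poissonHypotheses_of_contDiff`: some `R ≥ 0`, `C₁` with `BoxSupport Φ R`, …, `∫|∂₁²Φ(·,t₂)| ≤ C₁`;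
* `tsum_tsum_mul_periodic_eq_of_contDiff` (periodic `G : ℤ → ℤ → ℂ`) and
  **`tsum_tsum_mul_stdAddChar_eq_of_contDiff`** (`K : ZMod c → ZMod c → ℂ`):
  `Σ_{n₁}Σ_{n₂} Φ(n₁,n₂) K(n₁,n₂) = c⁻² Σ_{k₂}Σ_{k₁} Φ̂(k₁/c,k₂/c) · Σ_{x₁,x₂ : ZMod c} K(x₁,x₂) e_c(k₁x₁ + k₂x₂)`,
  so that with `K x₁ x₂ = S(αx₁, βx₂; c)` the inner sum IS the left side of d2's evaluation.

Folklore analysis, PROVED; theorems only; no bound on any off-diagonal term. Helper; closes nothing.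
«The programme SEARCHES and TYPES; no claim about Landau–Siegel zeros, Theorems 1–2 of arXiv:2211.02515
or a repaired Margin232 until a kernel theorem says so.»
-/

noncomputable section

open Real MeasureTheory Filter Complex Finset Set
open scoped FourierTransform Topology ContDiff

namespace Summit.Parity.GeneralizedHardyLittlewood.Theorems.BeyondDiagonalBeatsQuarter.OffDiagPoissonTwisted

open Literature.NumberTheory.Sieve.FriedlanderIwaniecPrimes

/-! ### Slices of a smooth function of two variables -/

section Slices

variable {Φ : ℝ → ℝ → ℂ}

/-- The `t₁`-slice through `t₂` is `F ∘ (translation by (0,t₂)) ∘ inl`, `F = uncurry Φ`. [folklore] -/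
theorem slice_left_eq_comp (Φ : ℝ → ℝ → ℂ) (t₂ : ℝ) :
    (fun t₁ => Φ t₁ t₂) = (fun z : ℝ × ℝ => Function.uncurry Φ (z + ((0 : ℝ), t₂))) ∘
      (ContinuousLinearMap.inl ℝ ℝ ℝ) := by
  funext t₁
  simp

/-- The `t₂`-slice through `t₁` is `F ∘ (translation by (t₁,0)) ∘ inr`. [folklore] -/
theorem slice_right_eq_comp (Φ : ℝ → ℝ → ℂ) (t₁ : ℝ) :
    Φ t₁ = (fun z : ℝ × ℝ => Function.uncurry Φ (z + (t₁, (0 : ℝ)))) ∘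
      (ContinuousLinearMap.inr ℝ ℝ ℝ) := by
  funext t₂
  simp

/-- Slices of a smooth function of two variables are smooth (first variable). [folklore] -/
theorem contDiff_slice_left (hΦ : ContDiff ℝ ∞ (Function.uncurry Φ)) (t₂ : ℝ) :
    ContDiff ℝ ∞ (fun t₁ => Φ t₁ t₂) :=
  hΦ.comp (contDiff_prodMk_left t₂)

/-- Slices of a smooth function of two variables are smooth (second variable). [folklore] -/
theorem contDiff_slice_right (hΦ : ContDiff ℝ ∞ (Function.uncurry Φ)) (t₁ : ℝ) :
    ContDiff ℝ ∞ (Φ t₁) :=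
  hΦ.comp (contDiff_prodMk_right t₁)

/-- **Slice formula, first variable**: `∂₁ⁿΦ(t₁,t₂) = DⁿF(t₁,t₂)(e₁,…,e₁)`, `F = uncurry Φ`,
`e₁ = (1,0)`. [folklore] -/
theorem iteratedDeriv_slice_left (hΦ : ContDiff ℝ ∞ (Function.uncurry Φ)) (n : ℕ) (t₁ t₂ : ℝ) :
    iteratedDeriv n (fun s => Φ s t₂) t₁ =
      iteratedFDeriv ℝ n (Function.uncurry Φ) (t₁, t₂) (fun _ => ((1 : ℝ), (0 : ℝ))) := by
  have hF : ContDiff ℝ ∞ (fun z : ℝ × ℝ => Function.uncurry Φ (z + ((0 : ℝ), t₂))) :=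
    hΦ.comp (contDiff_id.add contDiff_const)
  rw [iteratedDeriv_eq_iteratedFDeriv, slice_left_eq_comp Φ t₂,
    ContinuousLinearMap.iteratedFDeriv_comp_right _ hF _ (by exact_mod_cast le_top),
    ContinuousMultilinearMap.compContinuousLinearMap_apply, iteratedFDeriv_comp_add_right]
  congr 1
  simp

/-- **Slice formula, second variable**: `∂₂ⁿΦ(t₁,t₂) = DⁿF(t₁,t₂)(e₂,…,e₂)`, `e₂ = (0,1)`. [folklore] -/
theorem iteratedDeriv_slice_right (hΦ : ContDiff ℝ ∞ (Function.uncurry Φ)) (n : ℕ) (t₁ t₂ : ℝ) :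
    iteratedDeriv n (Φ t₁) t₂ =
      iteratedFDeriv ℝ n (Function.uncurry Φ) (t₁, t₂) (fun _ => ((0 : ℝ), (1 : ℝ))) := by
  have hF : ContDiff ℝ ∞ (fun z : ℝ × ℝ => Function.uncurry Φ (z + (t₁, (0 : ℝ)))) :=
    hΦ.comp (contDiff_id.add contDiff_const)
  rw [iteratedDeriv_eq_iteratedFDeriv, slice_right_eq_comp Φ t₁,
    ContinuousLinearMap.iteratedFDeriv_comp_right _ hF _ (by exact_mod_cast le_top),
    ContinuousMultilinearMap.compContinuousLinearMap_apply, iteratedFDeriv_comp_add_right]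
  congr 1
  simp

/-- `‖DⁿF(p)(v,…,v)‖ ≤ ‖DⁿF(p)‖` for `‖v‖ ≤ 1`. [folklore] -/
theorem norm_iteratedFDeriv_apply_const_le {F : ℝ × ℝ → ℂ} (n : ℕ) (p v : ℝ × ℝ) (hv : ‖v‖ ≤ 1) :
    ‖iteratedFDeriv ℝ n F p (fun _ => v)‖ ≤ ‖iteratedFDeriv ℝ n F p‖ := by
  refine (ContinuousMultilinearMap.le_opNorm _ _).trans ?_
  rw [Finset.prod_const, Finset.card_univ, Fintype.card_fin]
  exact mul_le_of_le_one_right (norm_nonneg _) (pow_le_one₀ (norm_nonneg _) hv)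

/-- `|∂₁ⁿΦ(t₁,t₂)| ≤ ‖DⁿF(t₁,t₂)‖`. [folklore] -/
theorem norm_iteratedDeriv_slice_left_le (hΦ : ContDiff ℝ ∞ (Function.uncurry Φ)) (n : ℕ) (t₁ t₂ : ℝ) :
    ‖iteratedDeriv n (fun s => Φ s t₂) t₁‖ ≤ ‖iteratedFDeriv ℝ n (Function.uncurry Φ) (t₁, t₂)‖ := by
  rw [iteratedDeriv_slice_left hΦ]
  exact norm_iteratedFDeriv_apply_const_le n _ _ (by simp [Prod.norm_def])

/-- `|∂₂ⁿΦ(t₁,t₂)| ≤ ‖DⁿF(t₁,t₂)‖`. [folklore] -/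
theorem norm_iteratedDeriv_slice_right_le (hΦ : ContDiff ℝ ∞ (Function.uncurry Φ)) (n : ℕ) (t₁ t₂ : ℝ) :
    ‖iteratedDeriv n (Φ t₁) t₂‖ ≤ ‖iteratedFDeriv ℝ n (Function.uncurry Φ) (t₁, t₂)‖ := by
  rw [iteratedDeriv_slice_right hΦ]
  exact norm_iteratedFDeriv_apply_const_le n _ _ (by simp [Prod.norm_def])

/-- `DⁿF` vanishes off `tsupport F`. [folklore] -/
theorem iteratedFDeriv_eq_zero_of_notMem_tsupport {F : ℝ × ℝ → ℂ} (n : ℕ) {p : ℝ × ℝ}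
    (hp : p ∉ tsupport F) : iteratedFDeriv ℝ n F p = 0 :=
  Function.notMem_support.mp fun h => hp (support_iteratedFDeriv_subset n h)

/-- `DⁿF` of a smooth compactly supported `F` is bounded: `∃ M, ∀ p, ‖DⁿF(p)‖ ≤ M`. [folklore] -/
theorem exists_norm_iteratedFDeriv_le {F : ℝ × ℝ → ℂ} (hF : ContDiff ℝ ∞ F)
    (hFc : HasCompactSupport F) (n : ℕ) : ∃ M : ℝ, ∀ p, ‖iteratedFDeriv ℝ n F p‖ ≤ M :=
  (hFc.iteratedFDeriv n).exists_bound_of_continuous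
    (hF.continuous_iteratedFDeriv (by exact_mod_cast le_top))

end Slices

/-! ### From smooth + compact support to the five hypotheses of `tsum_tsum_arithProg₂` -/

section SmoothBox

variable {Φ : ℝ → ℝ → ℂ}

/-- A compactly supported function on `ℝ²` is supported in a box `[-R,R]²`, `R > 0` (sup norm). [folklore] -/
theorem exists_tsupport_subset_box (hΦc : HasCompactSupport (Function.uncurry Φ)) :
    ∃ R : ℝ, 0 < R ∧ ∀ p ∈ tsupport (Function.uncurry Φ), |p.1| ≤ R ∧ |p.2| ≤ R := by
  obtain ⟨R, hR0, hR⟩ := hΦc.isCompact.isBounded.subset_closedBall_lt 0 0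
  refine ⟨R, hR0, fun p hp => ?_⟩
  have h := hR hp
  rw [Metric.mem_closedBall, dist_zero_right] at h
  exact ⟨(Real.norm_eq_abs p.1 ▸ norm_fst_le p).trans h, (Real.norm_eq_abs p.2 ▸ norm_snd_le p).trans h⟩

/-- Box support of `Φ` from a box containing `tsupport (uncurry Φ)`. [folklore] -/
theorem boxSupport_of_tsupport_subset {R : ℝ}
    (hR : ∀ p ∈ tsupport (Function.uncurry Φ), |p.1| ≤ R ∧ |p.2| ≤ R) : BoxSupport Φ R :=
  fun t₁ t₂ hne => hR (t₁, t₂) (subset_tsupport _ (Function.mem_support.mpr hne))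

/-- **Uniform `L¹` bound for `∂₁²Φ` along slices**: if `tsupport F ⊆ [-R,R]²` (`R ≥ 0`) and
`‖D²F‖ ≤ M`, then `∫ |∂₁²Φ(t₁,t₂)| dt₁ ≤ 2RM` for every `t₂`. [folklore] -/
theorem integral_norm_iteratedDeriv_slice_le (hΦ : ContDiff ℝ ∞ (Function.uncurry Φ)) {R M : ℝ}
    (hR0 : 0 ≤ R) (hR : ∀ p ∈ tsupport (Function.uncurry Φ), |p.1| ≤ R ∧ |p.2| ≤ R)
    (hM : ∀ p, ‖iteratedFDeriv ℝ 2 (Function.uncurry Φ) p‖ ≤ M) (t₂ : ℝ) :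
    (∫ t₁, ‖iteratedDeriv 2 (fun s => Φ s t₂) t₁‖) ≤ 2 * R * M := by
  have hzero : ∀ t₁, t₁ ∉ Icc (-R) R → ‖iteratedDeriv 2 (fun s => Φ s t₂) t₁‖ = 0 := by
    intro t₁ ht₁
    have hp : (t₁, t₂) ∉ tsupport (Function.uncurry Φ) := fun hp =>
      ht₁ (mem_Icc.mpr (abs_le.mp (hR _ hp).1))
    rw [iteratedDeriv_slice_left hΦ, iteratedFDeriv_eq_zero_of_notMem_tsupport 2 hp]
    simp
  have hpt : ∀ t₁ ∈ Icc (-R) R, ‖(‖iteratedDeriv 2 (fun s => Φ s t₂) t₁‖)‖ ≤ M := by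
    intro t₁ _
    rw [norm_norm]
    exact (norm_iteratedDeriv_slice_left_le hΦ 2 t₁ t₂).trans (hM _)
  rw [← setIntegral_eq_integral_of_forall_compl_eq_zero hzero]
  refine (le_abs_self _).trans ?_
  rw [← Real.norm_eq_abs]
  refine (norm_setIntegral_le_of_norm_le_const measure_Icc_lt_top hpt).trans (le_of_eq ?_)
  rw [Real.volume_real_Icc_of_le (by linarith), show R - -R = 2 * R by ring]
  ring

/-- **The five hypotheses of the two-variable Poisson formula from smoothness and compact support.**
For `Φ : ℝ → ℝ → ℂ` with `uncurry Φ` smooth of compact support there are `R ≥ 0` and `C₁` with: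
`BoxSupport Φ R`, `uncurry Φ` continuous, all slices smooth, and `∫ |∂₁²Φ(·,t₂)| ≤ C₁` for every `t₂`
(the hypotheses of `FriedlanderIwaniecPrimes.tsum_tsum_arithProg₂` / `tsum_tsum_mul_periodic_eq`). [folklore] -/
theorem poissonHypotheses_of_contDiff (hΦ : ContDiff ℝ ∞ (Function.uncurry Φ))
    (hΦc : HasCompactSupport (Function.uncurry Φ)) :
    ∃ R C₁ : ℝ, 0 ≤ R ∧ BoxSupport Φ R ∧ Continuous (Function.uncurry Φ) ∧
      (∀ t₂, ContDiff ℝ ∞ (fun t₁ => Φ t₁ t₂)) ∧ (∀ t₁, ContDiff ℝ ∞ (Φ t₁)) ∧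
      ∀ t₂, (∫ t₁, ‖iteratedDeriv 2 (fun t₁ => Φ t₁ t₂) t₁‖) ≤ C₁ := by
  obtain ⟨R, hR0, hR⟩ := exists_tsupport_subset_box hΦc
  obtain ⟨M, hM⟩ := exists_norm_iteratedFDeriv_le hΦ hΦc 2
  exact ⟨R, 2 * R * M, hR0.le, boxSupport_of_tsupport_subset hR, hΦ.continuous,
    contDiff_slice_left hΦ, contDiff_slice_right hΦ,
    integral_norm_iteratedDeriv_slice_le hΦ hR0.le hR hM⟩

/-- **Twisted Poisson summation in two variables for a smooth compactly supported weight** (iterated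
form): for `uncurry Φ` smooth of compact support, `c ≥ 1` and `G : ℤ → ℤ → ℂ` `c`-periodic in each
variable,
`Σ_{n₁} Σ_{n₂} Φ(n₁,n₂) G(n₁,n₂) = c⁻² Σ_{k₂} Σ_{k₁} Φ̂(k₁/c,k₂/c) · Σ_{x₁,x₂<c} G(x₁,x₂) e(x₁k₁/c) e(x₂k₂/c)`.
[folklore] -/
theorem tsum_tsum_mul_periodic_eq_of_contDiff (hΦ : ContDiff ℝ ∞ (Function.uncurry Φ))
    (hΦc : HasCompactSupport (Function.uncurry Φ)) {c : ℕ} (hc0 : 0 < c) {G : ℤ → ℤ → ℂ}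
    (hG₁ : ∀ u v n : ℤ, G (u + c * n) v = G u v) (hG₂ : ∀ u v n : ℤ, G u (v + c * n) = G u v) :
    ∑' n₁ : ℤ, ∑' n₂ : ℤ, Φ n₁ n₂ * G n₁ n₂ =
      ((c : ℂ)⁻¹) ^ 2 * ∑' k₂ : ℤ, ∑' k₁ : ℤ, fourier2 Φ (k₁ / c) (k₂ / c) *
        ∑ x₁ ∈ Finset.range c, ∑ x₂ ∈ Finset.range c,
          G x₁ x₂ * (𝐞 ((x₁ : ℝ) * k₁ / c) : ℂ) * (𝐞 ((x₂ : ℝ) * k₂ / c) : ℂ) := by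
  obtain ⟨R, C₁, hR, hbox, hcont, hs₁, hs₂, hC⟩ := poissonHypotheses_of_contDiff hΦ hΦc
  exact tsum_tsum_mul_periodic_eq hbox hcont hR hs₁ hs₂ hC hc0 hG₁ hG₂

end SmoothBox

/-! ### The complete sums in the shape of d2 (`ZMod.stdAddChar`) -/

section StdAddChar

variable {c : ℕ} [NeZero c]

/-- `𝐞(val(y)·k/c) = e_c(k·y)` for `y ∈ ℤ/c`, `k ∈ ℤ` (d2's bridge `OffDiag.fourierChar_int_mul_div_eq_stdAddChar`
at `x = val y`). [folklore] -/
theorem fourierChar_val_mul_div (y : ZMod c) (k : ℤ) :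
    (𝐞 ((y.val : ℝ) * k / c) : ℂ) = (ZMod.stdAddChar ((k : ZMod c) * y) : ℂ) := by
  have h := OffDiag.fourierChar_int_mul_div_eq_stdAddChar (c := c) (y.val : ℤ) k
  push_cast at h
  rw [h, ZMod.natCast_zmod_val, mul_comm]

/-- The twisted complete sum of part 1 in d2's shape:
`Σ_{y₁,y₂ : ZMod c} K y₁ y₂ · 𝐞(val y₁·k₁/c) 𝐞(val y₂·k₂/c) = Σ_{x₁,x₂ : ZMod c} K x₁ x₂ · e_c(k₁x₁ + k₂x₂)`.
[folklore] -/
theorem sum_sum_fourierChar_val_eq_stdAddChar (K : ZMod c → ZMod c → ℂ) (k₁ k₂ : ℤ) :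
    ∑ y₁ : ZMod c, ∑ y₂ : ZMod c,
        K y₁ y₂ * (𝐞 ((y₁.val : ℝ) * k₁ / c) : ℂ) * (𝐞 ((y₂.val : ℝ) * k₂ / c) : ℂ) =
      ∑ x₁ : ZMod c, ∑ x₂ : ZMod c,
        K x₁ x₂ * (ZMod.stdAddChar ((k₁ : ZMod c) * x₁ + (k₂ : ZMod c) * x₂) : ℂ) := by
  refine Finset.sum_congr rfl fun x₁ _ => Finset.sum_congr rfl fun x₂ _ => ?_
  rw [fourierChar_val_mul_div, fourierChar_val_mul_div, AddChar.map_add_eq_mul, mul_assoc]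

variable {Φ : ℝ → ℝ → ℂ}

/-- **Twisted Poisson summation in two variables, residue classes with `e_c`** (the hypotheses of part 1):
`Σ_{n₁} Σ_{n₂} Φ(n₁,n₂) K(n₁,n₂) = c⁻² Σ_{k₂} Σ_{k₁} Φ̂(k₁/c,k₂/c) · Σ_{x₁,x₂ : ZMod c} K(x₁,x₂) e_c(k₁x₁ + k₂x₂)`.
[folklore] -/
theorem tsum_tsum_mul_stdAddChar_eq {R : ℝ} (h : BoxSupport Φ R) (hc : Continuous (Function.uncurry Φ))
    (hR : 0 ≤ R) (hs₁ : ∀ t₂, ContDiff ℝ ∞ (fun t₁ => Φ t₁ t₂)) (hs₂ : ∀ t₁, ContDiff ℝ ∞ (Φ t₁))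
    {C₁ : ℝ} (hC : ∀ t₂, (∫ t₁, ‖iteratedDeriv 2 (fun t₁ => Φ t₁ t₂) t₁‖) ≤ C₁)
    (K : ZMod c → ZMod c → ℂ) :
    ∑' n₁ : ℤ, ∑' n₂ : ℤ, Φ n₁ n₂ * K (n₁ : ZMod c) (n₂ : ZMod c) =
      ((c : ℂ)⁻¹) ^ 2 * ∑' k₂ : ℤ, ∑' k₁ : ℤ, fourier2 Φ (k₁ / c) (k₂ / c) *
        ∑ x₁ : ZMod c, ∑ x₂ : ZMod c,
          K x₁ x₂ * (ZMod.stdAddChar ((k₁ : ZMod c) * x₁ + (k₂ : ZMod c) * x₂) : ℂ) := by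
  rw [tsum_tsum_mul_zmod_eq h hc hR hs₁ hs₂ hC K]
  congr 1
  refine tsum_congr fun k₂ => tsum_congr fun k₁ => ?_
  rw [sum_sum_fourierChar_val_eq_stdAddChar]

/-- **Twisted Poisson summation in two variables for a smooth compactly supported weight, in d2's
Kloosterman shape.** For `uncurry Φ` smooth of compact support, `c ≥ 1`, `K : ZMod c → ZMod c → ℂ`:
`Σ_{n₁} Σ_{n₂} Φ(n₁,n₂) K(n₁,n₂) = c⁻² Σ_{k₂} Σ_{k₁} Φ̂(k₁/c,k₂/c) · Σ_{x₁,x₂ : ZMod c} K(x₁,x₂) e_c(k₁x₁ + k₂x₂)`;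
with `K x₁ x₂ = S(αx₁, βx₂; c)` the inner sum is evaluated by `OffDiag.sum_sum_kloostermanSum_mul_stdAddChar`
(`h_i = k_i mod c`) and vanishes at `(k₁,k₂) = 0` for `α ≢ 0` (`OffDiag.sum_sum_kloostermanSum_eq_zero`).
[folklore] -/
theorem tsum_tsum_mul_stdAddChar_eq_of_contDiff (hΦ : ContDiff ℝ ∞ (Function.uncurry Φ))
    (hΦc : HasCompactSupport (Function.uncurry Φ)) (K : ZMod c → ZMod c → ℂ) :
    ∑' n₁ : ℤ, ∑' n₂ : ℤ, Φ n₁ n₂ * K (n₁ : ZMod c) (n₂ : ZMod c) =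
      ((c : ℂ)⁻¹) ^ 2 * ∑' k₂ : ℤ, ∑' k₁ : ℤ, fourier2 Φ (k₁ / c) (k₂ / c) *
        ∑ x₁ : ZMod c, ∑ x₂ : ZMod c,
          K x₁ x₂ * (ZMod.stdAddChar ((k₁ : ZMod c) * x₁ + (k₂ : ZMod c) * x₂) : ℂ) := by
  obtain ⟨R, C₁, hR, hbox, hcont, hs₁, hs₂, hC⟩ := poissonHypotheses_of_contDiff hΦ hΦc
  exact tsum_tsum_mul_stdAddChar_eq hbox hcont hR hs₁ hs₂ hC K

end StdAddChar

end Summit.Parity.GeneralizedHardyLittlewood.Theorems.BeyondDiagonalBeatsQuarter.OffDiagPoissonTwisted
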